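import Mathlib.Analysis.InnerProductSpace.PiL2
import Mathlib.Analysis.Convex.Star
import Mathlib.Analysis.Normed.Module.Convex

/-!
# SmoothPoincare4 / SullivanDual — crux `Target` (stmt-SmoothPoincare4-7823), line `Sketch`:
# flat geometry helper `helper_starConvex_ball_diff_halfAxis`

For the Mayer–Vietoris computation `H²_dR(B_r(c) ∖ {c}) = 0` in `ℝ⁴` the punctured ball is
covered by the two open pieces "ball minus the closed lower (`σ = 1`) / upper (`σ = -1`) half
of the `x₃`-axis through `c`".  This file proves that each piece is star-shaped with respect to
the point `a = c + (σ r / 2) e₃`, so that the star-shaped Poincaré lemma applies to it.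
-/

noncomputable section

-- the registered namespace `Summit.SmoothPoincare4.SmoothPoincare4.Theorems` repeats a component
set_option linter.dupNamespace false

open Set Metric

namespace Summit.SmoothPoincare4.SmoothPoincare4.Theorems

namespace SullivanDual

/-- **The ball minus a closed half of the `x₃`-axis is star-shaped.** For `σ = ±1`, the open
set of points `y` of the ball `B_r(c) ⊆ ℝ⁴` with `σ (y - c)₃ > 0` or `(y - c)ᵢ ≠ 0` for some
`i ∈ {0, 1, 2}` (the ball minus the closed half-axis `{c + s e₃ | σ s ≤ 0}`) is star-convex with
respect to `a = c + (σ r / 2) e₃`: a convex combination `t₁ a + t₂ y` stays in the (convex) ball,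
its coordinates `0, 1, 2` relative to `c` are `t₂ (y - c)ᵢ`, and `σ` times its third coordinate
is `t₁ r / 2 + t₂ σ (y - c)₃`. [folklore] -/
theorem helper_starConvex_ball_diff_halfAxis (c : EuclideanSpace ℝ (Fin 4)) {r σ : ℝ}
    (hr : 0 < r) (hσ : σ = 1 ∨ σ = -1) :
    StarConvex ℝ (c + (σ * (r / 2)) • EuclideanSpace.single (3 : Fin 4) (1 : ℝ))
      {y : EuclideanSpace ℝ (Fin 4) | y ∈ Metric.ball c r ∧
        (0 < σ * (y - c) 3 ∨ (y - c) 0 ≠ 0 ∨ (y - c) 1 ≠ 0 ∨ (y - c) 2 ≠ 0)} := by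
  have hσ2 : σ * σ = 1 := by rcases hσ with rfl | rfl <;> norm_num
  have hσabs : |σ| = 1 := by rcases hσ with rfl | rfl <;> norm_num
  set a : EuclideanSpace ℝ (Fin 4) :=
    c + (σ * (r / 2)) • EuclideanSpace.single (3 : Fin 4) (1 : ℝ) with ha_def
  -- the star centre relative to `c`
  have hac : a - c = (σ * (r / 2)) • EuclideanSpace.single (3 : Fin 4) (1 : ℝ) := by
    rw [ha_def, add_sub_cancel_left]
  have ha_ball : a ∈ Metric.ball c r := by
    rw [Metric.mem_ball, dist_eq_norm, hac, norm_smul, PiLp.norm_single, norm_one, mul_one,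
      Real.norm_eq_abs, abs_mul, hσabs, one_mul, abs_of_pos (half_pos hr)]
    exact half_lt_self hr
  have ha3 : (a - c) 3 = σ * (r / 2) := by
    rw [hac, PiLp.smul_apply, smul_eq_mul, PiLp.single_eq_same, mul_one]
  have ha_i : ∀ i : Fin 4, i ≠ 3 → (a - c) i = 0 := by
    intro i hi
    rw [hac, PiLp.smul_apply, smul_eq_mul, PiLp.single_eq_of_ne _ hi, mul_zero]
  intro y hy t₁ t₂ ht₁ ht₂ hsum
  rw [Set.mem_setOf_eq] at hy ⊢
  obtain ⟨hyb, hy⟩ := hy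
  refine ⟨convex_ball c r ha_ball hyb ht₁ ht₂ hsum, ?_⟩
  -- coordinates of the convex combination relative to `c`
  have hcoord : ∀ i, (t₁ • a + t₂ • y - c) i = t₁ * (a - c) i + t₂ * (y - c) i := by
    intro i
    have h : t₁ • a + t₂ • y - c = t₁ • (a - c) + t₂ • (y - c) := by
      calc t₁ • a + t₂ • y - c = t₁ • a + t₂ • y - (t₁ + t₂) • c := by rw [hsum, one_smul]
        _ = t₁ • (a - c) + t₂ • (y - c) := by rw [add_smul, smul_sub, smul_sub]; abel
    rw [h, PiLp.add_apply, PiLp.smul_apply, PiLp.smul_apply, smul_eq_mul, smul_eq_mul]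
  rw [hcoord 0, hcoord 1, hcoord 2, hcoord 3, ha3, ha_i 0 (by decide), ha_i 1 (by decide),
    ha_i 2 (by decide)]
  have key : σ * (t₁ * (σ * (r / 2)) + t₂ * (y - c) 3) = t₁ * (r / 2) + t₂ * (σ * (y - c) 3) := by
    have h : σ * (t₁ * (σ * (r / 2)) + t₂ * (y - c) 3) =
        σ * σ * (t₁ * (r / 2)) + t₂ * (σ * (y - c) 3) := by ring
    rw [h, hσ2, one_mul]
  rw [key]
  simp only [mul_zero, zero_add]
  rcases eq_or_lt_of_le ht₂ with h0 | h0
  · -- `t₂ = 0`: the combination is the centre `a` itself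
    subst h0
    left
    have ht1 : t₁ = 1 := by linarith
    rw [ht1, one_mul, zero_mul, add_zero]
    exact half_pos hr
  · -- `0 < t₂`
    rcases hy with h3 | h0' | h1' | h2'
    · left
      have hprod : 0 < t₂ * (σ * (y - c) 3) := mul_pos h0 h3
      have hnn : 0 ≤ t₁ * (r / 2) := mul_nonneg ht₁ (half_pos hr).le
      linarith
    · exact Or.inr (Or.inl (mul_ne_zero h0.ne' h0'))
    · exact Or.inr (Or.inr (Or.inl (mul_ne_zero h0.ne' h1')))
    · exact Or.inr (Or.inr (Or.inr (mul_ne_zero h0.ne' h2')))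

end SullivanDual

end Summit.SmoothPoincare4.SmoothPoincare4.Theorems
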